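import Literature.ModelTheory.Quasiminimal.ContinuumCCP
import Literature.ModelTheory.Quasiminimal.LocalIsoSystems
import HarnessLib

/-!
# Quasiminimality of the continuum model

Let `S : Setup L M cl` be the data of `ContinuumModel.lean` (a countable exponential field `M`
with a weakly quasiminimal pregeometry structure and a basis, whose self-embeddings are E-ring
endomorphisms and whose quantifier-free `L`-types refine the quantifier-free types of the
language of exponential rings) and `F = S.F` its continuum model, the direct limit of the charts
`M` along the closed self-embeddings `Ψ X Y`. We prove that `F` is **quasiminimal** for the
language of exponential rings: every subset of `F` definable with parameters is countable or
co-countable (`Setup.isQuasiminimal_F`).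

The proof is Kirby's Lemma 5.1 in the excellence-free form of the tree
(`FirstOrder.Language.IsLocalIsoSystem.countable_or_countable_compl`, `LocalIsoSystems.lean`):
the relation "`x` and `y` come from a common chart with preimages of the same quantifier-free
`L`-type" is a back-and-forth system of local isomorphisms on `F` (forth: inside a common chart,
by `ℵ₀`-homogeneity over `∅` (QM5) when the new point is in the closure of the tuple, and by a
fresh generic point, Thm 2.1 and the uniqueness of the generic type (QM4) otherwise), and any
two points outside the countable closure of a finite tuple `b` are conjugate over `b` (QM4 in a
common chart, closures commuting with the closed embeddings `Ψ`).

## References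

* J. Kirby, *On quasiminimal excellent classes*, J. Symbolic Logic 75 (2010), Lemma 5.1.
* M. Bays, B. Hart, T. Hyttinen, M. Kesälä, J. Kirby, *Quasiminimal structures and excellence*,
  Bull. LMS 46 (2014), Prop. 7.1.
* M. Bays, J. Kirby, *Pseudo-exponential maps, variants, and quasiminimality*, Algebra & Number
  Theory 12 (2018), Thm 6.9 / Cor. 9.4 (quasiminimality of the models).
-/

noncomputable section

suppress_compilation

open Set FirstOrder FirstOrder.Language Cardinal
open Literature.ModelTheory.ExponentialFields

namespace FirstOrder.Language.EqQFType

variable {L : Language} {M : Type*} [L.Structure M] {α : Type*}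

/-- Tuples with the same quantifier-free type satisfy the same unnested function facts
`x i = f (x ∘ ι)`. [folklore] -/
theorem apply_eq_funMap_iff {x y : α → M} (h : L.EqQFType x y) {k : ℕ} (f : L.Functions k)
    (ι : Fin k → α) (i : α) :
    x i = Structure.funMap f (x ∘ ι) ↔ y i = Structure.funMap f (y ∘ ι) := by
  have := h (Term.equal (var i) (func f fun j => var (ι j))) (by
    change BoundedFormula.IsAtomic (Term.bdEqual _ _)
    exact BoundedFormula.IsAtomic.equal _ _)
  simpa only [Formula.realize_equal, Term.realize_var, Term.realize_func, Function.comp_def]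
    using this

end FirstOrder.Language.EqQFType

namespace Literature.ModelTheory.Quasiminimal

namespace Setup

variable {L : Language.{0, 0}} {M : Type} [L.Structure M] [Field M] [ExponentialRing M]
  {cl : Set M → Set M} (S : Setup L M cl)

/-! ### Charts of tuples -/

/-- `Ψ` preserves quantifier-free types of tuples. [folklore] -/
theorem eqQFType_Ψ_comp {Z W : Finset ℝ} (h : Z ⊆ W) {n : ℕ} (xt : Fin n → M) :
    L.EqQFType xt (S.Ψ Z W ∘ xt) :=
  S.Ψ_isQFEmbOn h xt fun _ => mem_univ _

/-- The structure maps are E-ring morphisms: they commute with the basic functions of the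
language of exponential rings. [folklore] -/
theorem funMap_comp_of (Z : Finset ℝ) {k : ℕ} (f : Language.expRing.Functions k)
    (v : Fin k → M) :
    Structure.funMap f (S.of Z ∘ v) = S.of Z (Structure.funMap f v) := by
  cases f
  · change S.of Z (v 0) + S.of Z (v 1) = S.of Z (v 0 + v 1); rw [map_add]
  · change S.of Z (v 0) * S.of Z (v 1) = S.of Z (v 0 * v 1); rw [map_mul]
  · change -S.of Z (v 0) = S.of Z (-v 0); rw [map_neg]
  · change (0 : S.F) = S.of Z 0; rw [map_zero]
  · change (1 : S.F) = S.of Z 1; rw [map_one]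
  · change ExponentialRing.exp (S.of Z (v 0)) = S.of Z (ExponentialRing.exp (v 0))
    exact S.exp_of Z (v 0)

/-! ### Infinite dimension of `M` -/

include S in
/-- `M` is infinite dimensional: no finite tuple spans. [folklore] -/
theorem exists_notMem_cl_range {n : ℕ} (y : Fin n → M) : ∃ m : M, m ∉ cl (range y) := by
  classical
  have hP := S.isWQPS.isPregeometry
  -- each `y j` lies in the closure of finitely many basis vectors
  have hy : ∀ j, ∃ I : Finset (ℕ ⊕ (ℕ ⊕ ℕ)), y j ∈ cl (S.b '' ↑I) := by
    intro j
    have hj : y j ∈ cl (range S.b) := by rw [S.span]; exact mem_univ _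
    obtain ⟨A₀, hA₀, hfin, hj₀⟩ := hP.finite_character hj
    -- `A₀ ⊆ range b` finite: choose preimages
    have : ∀ a : A₀, ∃ i, S.b i = a := fun a => hA₀ a.2
    choose g hg using this
    haveI := hfin.fintype
    refine ⟨Finset.univ.image g, hP.mono ?_ hj₀⟩
    intro a ha
    exact ⟨g ⟨a, ha⟩, by simp, hg ⟨a, ha⟩⟩
  choose I hI using hy
  set J : Finset (ℕ ⊕ (ℕ ⊕ ℕ)) := Finset.univ.biUnion I with hJ
  -- a basis vector outside `J`
  obtain ⟨i₀, hi₀⟩ : ∃ i₀ : ℕ ⊕ (ℕ ⊕ ℕ), i₀ ∉ J := Infinite.exists_notMem_finset J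
  refine ⟨S.b i₀, fun hmem => ?_⟩
  have hsub : range y ⊆ cl (S.b '' ↑J) := by
    rintro _ ⟨j, rfl⟩
    exact hP.mono (image_mono (by
      intro i hi
      exact Finset.mem_biUnion.2 ⟨j, Finset.mem_univ j, hi⟩)) (hI j)
  have h1 : S.b i₀ ∈ cl (S.b '' ↑J) := by
    have := hP.mono hsub hmem
    rwa [hP.cl_cl] at this
  refine S.indep i₀ ?_
  rw [empty_union]
  refine hP.mono (image_mono fun i (hi : i ∈ (↑J : Set (ℕ ⊕ (ℕ ⊕ ℕ)))) => ?_) h1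
  rintro (rfl : i = i₀)
  exact hi₀ hi

/-! ### The back-and-forth system on `F` -/

/-- `x ~ y`: the tuples `x, y` of `F` come from a common chart with preimages of the same
quantifier-free `L`-type. [folklore] -/
def ChartRel (n : ℕ) (x y : Fin n → S.F) : Prop :=
  ∃ (Z : Finset ℝ) (xt yt : Fin n → M), S.of Z ∘ xt = x ∧ S.of Z ∘ yt = y ∧ L.EqQFType xt yt

include S in
/-- Forth inside one chart: `qftp(x') = qftp(y')` and a point `a` give `b` with
`qftp(x', a) = qftp(y', b)`. [cite: Kirby2010QMEC, Thm 2.1 (proof)] -/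
theorem exists_snoc_eqQFType {n : ℕ} {x' y' : Fin n → M} (h : L.EqQFType x' y') (a : M) :
    ∃ b : M, L.EqQFType (Fin.snoc x' a : Fin (n + 1) → M) (Fin.snoc y' b) := by
  haveI := S.countable
  have hW := S.isWQPS
  have hP := hW.isPregeometry
  by_cases ha : a ∈ cl (range x')
  · -- QM5 over `∅`
    obtain ⟨b, hb⟩ := hW.homogeneity_over_closed ∅ id countable_empty (Or.inr rfl) x' y'
      (eqQFTypeOver_empty_iff.2 h) (a := a) (by rwa [empty_union])
    exact ⟨b, eqQFTypeOver_empty_iff.1 hb⟩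
  · -- a fresh generic point, Thm 2.1 on the closures, and QM4
    obtain ⟨b, hb⟩ := S.exists_notMem_cl_range y'
    obtain ⟨F₀, hF₀, -, hF₀x, hF₀im⟩ := hW.exists_isQFEmbOn_cl_extend (G := ∅) (f := id)
      countable_empty (Or.inr rfl) (eqQFTypeOver_empty_iff.2 h)
    rw [empty_union] at hF₀ hF₀im
    rw [image_empty, empty_union] at hF₀im
    have hH : (cl (range x')).Countable := hW.countable_cl _ (finite_range x')
    have hgen := hW.uniqueness_of_generic_type (cl (range x')) F₀ hH (hP.cl_cl _)
      (by rw [hF₀im, hP.cl_cl]) ((isQFEmbOn_iff_eqQFTypeOver_elim0).1 hF₀) ha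
      (a' := b) (by rwa [hF₀im])
    refine ⟨b, ?_⟩
    have key := hgen x' fun i => hP.subset_cl _ (mem_range_self i)
    have hFx : F₀ ∘ x' = y' := funext hF₀x
    rw [hFx, Fin.append_right_eq_snoc, Fin.append_right_eq_snoc] at key
    simpa using key

/-- **The chart relation is a back-and-forth system of local isomorphisms** for the language of
exponential rings. [cite: Kirby2010QMEC, Lemma 5.1] -/
theorem isLocalIsoSystem_chartRel : Language.expRing.IsLocalIsoSystem S.ChartRel where
  symm := by
    rintro n x y ⟨Z, xt, yt, hx, hy, h⟩
    exact ⟨Z, yt, xt, hy, hx, h.symm⟩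
  comp := by
    rintro n x y ⟨Z, xt, yt, rfl, rfl, h⟩ m g
    exact ⟨Z, xt ∘ g, yt ∘ g, rfl, rfl, h.comp g⟩
  apply_eq := by
    rintro n x y ⟨Z, xt, yt, rfl, rfl, h⟩ i j hij
    have : xt i = xt j := S.of_injective Z hij
    change S.of Z (yt i) = S.of Z (yt j)
    rw [(h.apply_eq_iff i j).1 this]
  funMap_eq := by
    rintro n x y ⟨Z, xt, yt, rfl, rfl, h⟩ k f ι i hxi
    have h1 : xt i = Structure.funMap f (xt ∘ ι) := by
      apply S.of_injective Z
      rw [← S.funMap_comp_of Z f (xt ∘ ι)]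
      exact hxi
    have h2 : yt i = Structure.funMap f (yt ∘ ι) :=
      ((S.expRing_of_eqQFType xt yt h).apply_eq_funMap_iff f ι i).1 h1
    change S.of Z (yt i) = Structure.funMap f ((S.of Z ∘ yt) ∘ ι)
    rw [h2, Function.comp_assoc, S.funMap_comp_of Z f (yt ∘ ι)]
  relMap := by
    rintro n x y - k R
    exact (R : Empty).elim
  forth := by
    rintro n x y ⟨Z, xt, yt, rfl, rfl, h⟩ a
    obtain ⟨Za, ma, hma⟩ := ExpDirectLimit.exists_of S.hom a
    -- common chart
    set W := Z ∪ Za with hWdef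
    have hZ : Z ⊆ W := Finset.subset_union_left
    have hZa : Za ⊆ W := Finset.subset_union_right
    have h' : L.EqQFType (S.Ψ Z W ∘ xt) (S.Ψ Z W ∘ yt) :=
      ((S.eqQFType_Ψ_comp hZ xt).symm.trans h).trans (S.eqQFType_Ψ_comp hZ yt)
    obtain ⟨b, hb⟩ := S.exists_snoc_eqQFType h' (S.Ψ Za W ma)
    refine ⟨S.of W b, W, Fin.snoc (S.Ψ Z W ∘ xt) (S.Ψ Za W ma), Fin.snoc (S.Ψ Z W ∘ yt) b,
      ?_, ?_, hb⟩
    · rw [Fin.comp_snoc, ← Function.comp_assoc]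
      congr 1
      · exact funext fun i => S.of_Ψ' hZ (xt i)
      · rw [S.of_Ψ' hZa, hma]
    · rw [Fin.comp_snoc, ← Function.comp_assoc]
      congr 1
      exact funext fun i => S.of_Ψ' hZ (yt i)

/-- Outside the (countable) closure of a finite tuple, any two points are conjugate over it.
[cite: Kirby2010QMEC, Lemma 5.1] -/
theorem chartRel_generic {k : ℕ} (b : Fin k → S.F) : ∃ H : Set S.F, H.Countable ∧
    ∀ ⦃a c : S.F⦄, a ∉ H → c ∉ H → S.ChartRel (k + 1) (Fin.snoc b a) (Fin.snoc b c) := by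
  haveI := S.countable
  have hW := S.isWQPS
  have hP := hW.isPregeometry
  obtain ⟨Z₀, bt, hbt⟩ := S.exists_chart_family b
  refine ⟨S.of Z₀ '' cl (range bt), (hW.countable_cl _ (finite_range bt)).image _, ?_⟩
  intro a c ha hc
  obtain ⟨Za, ma, hma⟩ := ExpDirectLimit.exists_of S.hom a
  obtain ⟨Zc, mc, hmc⟩ := ExpDirectLimit.exists_of S.hom c
  set W := Z₀ ∪ Za ∪ Zc with hWdef
  have h0 : Z₀ ⊆ W := Finset.subset_union_left.trans Finset.subset_union_left
  have ha' : Za ⊆ W := Finset.subset_union_right.trans Finset.subset_union_left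
  have hc' : Zc ⊆ W := Finset.subset_union_right
  set bt' : Fin k → M := S.Ψ Z₀ W ∘ bt with hbt'
  -- the closure of `bt'` maps onto `H`
  have hclim : S.of W '' cl (range bt') = S.of Z₀ '' cl (range bt) := by
    rw [hbt', range_comp, ← S.image_cl_Ψ' h0, image_image]
    exact image_congr fun m _ => S.of_Ψ' h0 m
  have hma' : S.Ψ Za W ma ∉ cl (range bt') := fun hmem => ha (by
    rw [← hclim, ← hma, ← S.of_Ψ' ha' ma]; exact mem_image_of_mem _ hmem)
  have hmc' : S.Ψ Zc W mc ∉ cl (range bt') := fun hmem => hc (by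
    rw [← hclim, ← hmc, ← S.of_Ψ' hc' mc]; exact mem_image_of_mem _ hmem)
  -- QM4 over the closure of `bt'`, with the identity matching
  have hH : (cl (range bt')).Countable := hW.countable_cl _ (finite_range bt')
  have hgen := hW.uniqueness_of_generic_type (cl (range bt')) id hH (hP.cl_cl _)
    (by rw [image_id, hP.cl_cl]) (eqQFTypeOver_elim0 fun _ σ _ => EqQFType.refl σ) hma'
    (a' := S.Ψ Zc W mc) (by rwa [image_id])
  have key := hgen bt' fun i => hP.subset_cl _ (mem_range_self i)
  rw [Function.id_comp, Fin.append_right_eq_snoc, Fin.append_right_eq_snoc] at key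
  simp only [Matrix.cons_val_fin_one] at key
  refine ⟨W, Fin.snoc bt' (S.Ψ Za W ma), Fin.snoc bt' (S.Ψ Zc W mc), ?_, ?_, key⟩
  · rw [Fin.comp_snoc, S.of_Ψ' ha', hma, ← hbt]
    congr 1
    exact funext fun i => S.of_Ψ' h0 (bt i)
  · rw [Fin.comp_snoc, S.of_Ψ' hc', hmc, ← hbt]
    congr 1
    exact funext fun i => S.of_Ψ' h0 (bt i)

/-- **The continuum model is quasiminimal** for the language of exponential rings: every
parametrically definable subset is countable or co-countable (Kirby 2010 Lemma 5.1 / BHHKK 2014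
Prop. 7.1 applied to the chart relation; Bays–Kirby 2018 Cor. 9.4 for the models of `ECF_SK,CCP`).
[cite: Kirby2010QMEC, Lemma 5.1] [cite: BaysKirby2018ANT, Cor. 9.4] -/
theorem isQuasiminimal_F : Language.expRing.IsQuasiminimal S.F :=
  fun _ hS => S.isLocalIsoSystem_chartRel.countable_or_countable_compl S.chartRel_generic hS

end Setup

end Literature.ModelTheory.Quasiminimal

end
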